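import Summits.RiemannHypothesis.RiemannHypothesis.Theorems.SignConeCondRungAssembly
import Summits.RiemannHypothesis.RiemannHypothesis.Theorems.SignConePointwiseIdentityH
import Summits.RiemannHypothesis.RiemannHypothesis.Theorems.SignConePointwiseBounds
import Literature.Analysis.SpecialFunctions.DigammaGauss

/-!
# Route SignCone — conditional rungs, V: the honest-weight slack density and its high/low-frequency bounds

Items stmt-RiemannHypothesis-16301/16302. The concrete input of Theorem A (`unitSlackWeil_of_rhUpTo`,
`SignConeCondRungAssembly`): with the HONEST weights `a_n = 2Λ(n)/√n` on `n ≤ N′` (`e^{2b′} < N′ + 1`), a plateau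
kernel `E = d.kernelE` (`= e^{x/2} + e^{-x/2}` on `[-2b′, 2b′]`) and an SOS correction `Hsos` whose frequencies lie
beyond `2b′`, the density
`F⁺(y) = Re ψ(¼ + iy/2) − log π + 1 + Ê(y) − Σ_{n ≤ N′} a_n cos(y log n) + Hsos(y)`
is a slack density at cutoff `b′` (`isSlackDensity_honest`: the landed spectral identity
`slackFunctional_eq_spectralIntegral` with slack `1`, the out-of-window pairing `integral_norm_sq_mul_Hsos_eq_zero`,
and `P_Λ(U) = Σ_{n ≤ N′} Λ(n) n^{-1/2}(U(log n) + U(−log n))` for `U` supported in `[-2b′, 2b′]`), and it obeys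
`F⁺(y) ≥ log(Y₂/2) − 2/Y₂² − π/(2Y₂) − log π + 1 − C_E/(¼ + Y₂²) − M` for `|y| > Y₂ ≥ 1` and
`F⁺(y) ≥ −(4.3723 + 4C_E + M)` everywhere, given an SOS-type bound `Σ a_n cos(y log n) − Hsos(y) ≤ M`
(`honest_density_highFreq`, `honest_density_lowBand`; digamma: `log_norm_sub_le_re_digamma`, `re_digamma_one_quarter_ge`).
-/

noncomputable section

-- `Summit.RiemannHypothesis.RiemannHypothesis.…` repeats a namespace component by design (D-0017 layout).
set_option linter.dupNamespace false

open scoped BigOperators ComplexConjugate Real Topology ArithmeticFunction.vonMangoldt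
open Complex MeasureTheory Set Filter

namespace Summit.RiemannHypothesis.RiemannHypothesis.Theorems.SignCone

open Literature.NumberTheory.LFunctions Literature.Analysis.SpecialFunctions

/-- The honest comb `Σ_{n ≤ N′} (2Λ(n)/√n) cos(y log n)`. [folklore] -/
def honestComb (N' : ℕ) (y : ℝ) : ℝ :=
  ∑ n ∈ Finset.range (N' + 1), 2 * Λ n / Real.sqrt n * Real.cos (y * Real.log n)

/-- The honest-weight slack density `F⁺ = Re ψ(¼+iy/2) − log π + 1 + Ê − comb + Hsos`. [folklore] -/
def honestDensity (d : PWKernel) (N' : ℕ) (Z : SOSData) (y : ℝ) : ℝ :=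
  reDigammaQuarter y - Real.log π + 1 + cosTransform d.kernelE y - honestComb N' y + Z.Hsos y

section Represent

variable {b' : ℝ} {d : PWKernel} (hdh : 0 < d.h) (hdL : (d.L : ℝ) = 2 * b')
  {N' : ℕ} (hN : Real.exp (2 * b') < N' + 1) {Z : SOSData} (hT : 0 < Z.T) {Lq : ℚ} (hLq : 2 * b' ≤ Lq)
  (hexp : Real.exp Lq < Z.T)

/-- `|Hsos(y)| ≤ Σ_{classes} |C_{pq}/4^S|`. [folklore] -/
theorem abs_Hsos_le (Z : SOSData) (y : ℝ) :
    |Z.Hsos y| ≤ ∑ pq ∈ ratioClasses Z.Np, |((Z.classSum pq.1 pq.2 / 4 ^ Z.S : ℚ) : ℝ)| := by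
  unfold SOSData.Hsos
  refine (Finset.abs_sum_le_sum_abs _ _).trans (Finset.sum_le_sum fun pq _ => ?_)
  split_ifs
  · rw [abs_mul]
    exact mul_le_of_le_one_right (abs_nonneg _) (Real.abs_cos_le_one _)
  · simp

/-- `Hsos` is continuous. [folklore] -/
theorem continuous_Hsos (Z : SOSData) : Continuous Z.Hsos := by
  unfold SOSData.Hsos
  refine continuous_finsetSum _ fun pq _ => ?_
  split_ifs
  · exact continuous_const.mul (Real.continuous_cos.comp (continuous_id.mul continuous_const))
  · exact continuous_const

/-- `|honestComb N′ y| ≤ Σ |2Λ(n)/√n|`. [folklore] -/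
theorem abs_honestComb_le (N' : ℕ) (y : ℝ) :
    |honestComb N' y| ≤ ∑ n ∈ Finset.range (N' + 1), |2 * Λ n / Real.sqrt n| := by
  unfold honestComb
  refine (Finset.abs_sum_le_sum_abs _ _).trans (Finset.sum_le_sum fun n _ => ?_)
  rw [abs_mul]
  exact mul_le_of_le_one_right (abs_nonneg _) (Real.abs_cos_le_one _)

/-- The honest comb is continuous. [folklore] -/
theorem continuous_honestComb (N' : ℕ) : Continuous (honestComb N') := by
  unfold honestComb
  exact continuous_finsetSum _ fun n _ =>
    continuous_const.mul (Real.continuous_cos.comp (continuous_id.mul continuous_const))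

include hdh in
/-- The honest density is continuous. [folklore] -/
theorem continuous_honestDensity : Continuous (honestDensity d N' Z) := by
  unfold honestDensity
  exact ((((continuous_reDigammaQuarter.sub continuous_const).add continuous_const).add
    (continuous_cosTransform d.continuous_kernelE (d.hasCompactSupport_kernelE hdh))).sub
      (continuous_honestComb N')).add (continuous_Hsos Z)

include hN in
/-- For `U` supported in `[-2b′, 2b′]` with `e^{2b′} < N′ + 1`: the prime term is the finite honest node sum,
`P_Λ(U) = Σ_{n ≤ N′} ((2Λ(n)/√n)/2)(U(log n) + U(−log n))`. [folklore] -/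
theorem weilPrimeTerm_eq_honest_sum {U : ℝ → ℂ} (hU : Continuous U)
    (hUs : tsupport U ⊆ Icc (-(2 * b')) (2 * b')) :
    weilPrimeTerm U = ∑ n ∈ Finset.range (N' + 1), (((2 * Λ n / Real.sqrt n) / 2 : ℝ) : ℂ) *
      (U (Real.log n) + U (-Real.log n)) := by
  unfold weilPrimeTerm
  have hsuppo := support_subset_Ioo_of_tsupport_subset_Icc hU hUs
  rw [tsum_eq_sum (s := Finset.range (N' + 1))]
  · refine Finset.sum_congr rfl fun n _ => ?_
    congr 1
    push_cast
    ring
  · intro n hn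
    rw [Finset.mem_range, not_lt] at hn
    have hn1 : (N' : ℝ) + 1 ≤ n := by exact_mod_cast hn
    have hpos : (0 : ℝ) < n := by linarith [Real.exp_pos (2 * b')]
    have hlog : 2 * b' < Real.log n := by
      rw [Real.lt_log_iff_exp_lt hpos]; linarith
    have h1 : U (Real.log n) = 0 := by
      by_contra hne; have := (hsuppo hne).2; linarith
    have h2 : U (-Real.log n) = 0 := by
      by_contra hne; have := (hsuppo hne).1; linarith
    simp [h1, h2]

include hdh hdL hN hT hLq hexp in
/-- **The honest density is a slack density at cutoff `b′`.** [folklore] -/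
theorem isSlackDensity_honest : IsSlackDensity b' (honestDensity d N' Z) := by
  intro u hu hus
  set U := weilConv u (weilReflect u) with hUdef
  have hUt : IsWeilTest U := hu.weilConv hu.weilReflect
  have hUs : tsupport U ⊆ Icc (-(2 * b')) (2 * b') := tsupport_weilConv_weilReflect_subset hu.2 hus
  have hEc := d.continuous_kernelE
  have hEs := d.hasCompactSupport_kernelE hdh
  have hEeq : ∀ x ∈ Icc (-(2 * b')) (2 * b'), d.kernelE x = Real.exp (x / 2) + Real.exp (-(x / 2)) := by
    have := d.kernelE_eq_on_Icc hdh; rwa [hdL] at this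
  set ρ : ℝ → ℝ := fun y => ‖weilMellin u (1 / 2 + y * I)‖ ^ 2 with hρ
  -- integrability: |F⁺| ≤ A + 27 y²
  set A : ℝ := |reDigammaQuarter 0| + |Real.log π| + 1 + (∫ x, |d.kernelE x|) +
    (∑ n ∈ Finset.range (N' + 1), |2 * Λ n / Real.sqrt n|) +
    ∑ pq ∈ ratioClasses Z.Np, |((Z.classSum pq.1 pq.2 / 4 ^ Z.S : ℚ) : ℝ)| with hA
  have hA0 : 0 ≤ A := by
    have : 0 ≤ ∫ x, |d.kernelE x| := integral_nonneg fun _ => abs_nonneg _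
    positivity
  have hbound : ∀ y, |honestDensity d N' Z y| ≤ A + 27 * y ^ 2 := by
    intro y
    have h1 := abs_reDigammaQuarter_le y
    have h2 := abs_cosTransform_le hEc hEs y
    have h3 := abs_honestComb_le N' y
    have h4 := abs_Hsos_le Z y
    unfold honestDensity
    rw [abs_le] at h1 h2 h3 h4 ⊢
    have h5 := abs_le.1 (le_refl |Real.log π|)
    constructor <;> nlinarith [h1.1, h1.2, h2.1, h2.2, h3.1, h3.2, h4.1, h4.2, h5.1, h5.2, sq_nonneg y]
  have hint : Integrable fun y => ρ y * honestDensity d N' Z y :=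
    integrable_norm_sq_weilMellin_mul hu (continuous_honestDensity hdh).measurable hA0 (by norm_num) hbound
  refine ⟨hint, ?_⟩
  -- the identity
  have hid := slackFunctional_eq_spectralIntegral hu hus hEc hEs hEeq 1 (Finset.range (N' + 1))
    (fun n => 2 * Λ n / Real.sqrt n)
  have hfreq : ∀ pq ∈ ratioClasses Z.Np, Z.isOut pq.1 pq.2 = true → 2 * b' < |Real.log pq.1 - Real.log pq.2| := by
    intro pq hpq hout
    simp only [ratioClasses, Finset.mem_filter, Finset.mem_product, Finset.mem_Icc] at hpq
    have := Z.lt_abs_log_sub_of_isOut hT hexp hpq.1.1.1 hpq.1.2.1 hout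
    exact lt_of_le_of_lt hLq this
  have hH0 := integral_norm_sq_mul_Hsos_eq_zero hu hus Z hfreq
  have hW : (weilFunctional U).re = (weilPolarTerm U + weilArchTerm U -
      ∑ n ∈ Finset.range (N' + 1), (((2 * Λ n / Real.sqrt n) / 2 : ℝ) : ℂ) * (U (Real.log n) + U (-Real.log n))).re := by
    rw [weilFunctional, weilPrimeTerm_eq_honest_sum hN hUt.1.continuous hUs]
    congr 1
    ring
  -- assemble: ∫ ρ F⁺ = ∫ ρ F + ∫ ρ Hsos = ∫ ρ F
  have iH : Integrable fun y => ρ y * Z.Hsos y := by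
    refine integrable_norm_sq_weilMellin_mul hu (continuous_Hsos Z).measurable (A := ∑ pq ∈ ratioClasses Z.Np,
      |((Z.classSum pq.1 pq.2 / 4 ^ Z.S : ℚ) : ℝ)|) (B := 0) (Finset.sum_nonneg fun _ _ => abs_nonneg _) le_rfl
      fun y => ?_
    rw [zero_mul, add_zero]; exact abs_Hsos_le Z y
  have iF : Integrable fun y => ρ y * (reDigammaQuarter y - Real.log π + 1 + cosTransform d.kernelE y -
      ∑ n ∈ Finset.range (N' + 1), 2 * Λ n / Real.sqrt n * Real.cos (y * Real.log n)) := by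
    have e : (fun y => ρ y * (reDigammaQuarter y - Real.log π + 1 + cosTransform d.kernelE y -
        ∑ n ∈ Finset.range (N' + 1), 2 * Λ n / Real.sqrt n * Real.cos (y * Real.log n))) =
        fun y => ρ y * honestDensity d N' Z y - ρ y * Z.Hsos y := by
      funext y; simp only [honestDensity, honestComb]; ring
    rw [e]; exact hint.sub iH
  have hsplit : (∫ y, ρ y * honestDensity d N' Z y) = (∫ y, ρ y * (reDigammaQuarter y - Real.log π + 1 +
      cosTransform d.kernelE y - ∑ n ∈ Finset.range (N' + 1), 2 * Λ n / Real.sqrt n * Real.cos (y * Real.log n))) +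
      ∫ y, ρ y * Z.Hsos y := by
    rw [← integral_add iF iH]
    congr 1 with y
    simp only [honestDensity, honestComb]; ring
  rw [hW, hsplit, hH0, add_zero, ← hid, one_mul]

end Represent

/-! ### High- and low-frequency bounds of the honest density -/

section Bounds

variable {d : PWKernel} (hdL0 : 0 ≤ d.L) (hdh : 0 < d.h) {N' : ℕ} {Z : SOSData} {M : ℝ}
  (hcomb : ∀ y : ℝ, honestComb N' y - Z.Hsos y ≤ M)
include hdL0 hdh hcomb

/-- **Low band**: `F⁺(y) ≥ −(4.3723 + 4 C_E + M)` for every `y`. [folklore] -/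
theorem honestDensity_lowBand (y : ℝ) :
    -(4.3723 + 4 * d.decayConst + M) ≤ honestDensity d N' Z y := by
  unfold honestDensity
  have h1 : (-4.22745354 : ℝ) ≤ reDigammaQuarter y := by
    have := reDigammaQuarter_zero_le y
    have h0 : (-4.22745354 : ℝ) ≤ reDigammaQuarter 0 := by
      unfold reDigammaQuarter; simpa using re_digamma_one_quarter_ge
    linarith
  have h2 := Real.log_pi_le
  have h3 : |cosTransform d.kernelE y| ≤ 4 * d.decayConst := by
    refine (PWKernel.abs_cosTransform_kernelE_le hdL0 hdh y).trans ?_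
    have hC : 0 ≤ d.decayConst := by
      have := (abs_nonneg _).trans (PWKernel.abs_cosTransform_kernelE_le hdL0 hdh 0)
      have hq : (0 : ℝ) < 1 / 4 + 0 ^ 2 := by norm_num
      exact (div_nonneg_iff.1 this).elim (fun h => h.1) fun h => absurd h.2 (not_le.2 hq) 
    rw [div_le_iff₀ (by positivity)]
    nlinarith [sq_nonneg y]
  have h4 := hcomb y
  have := neg_abs_le (cosTransform d.kernelE y)
  linarith

/-- **High frequencies**: for `|y| > Y₂ ≥ 1`,
`F⁺(y) ≥ log(Y₂/2) − 2/Y₂² − π/(2Y₂) − log π + 1 − C_E/(¼ + Y₂²) − M`. [folklore] -/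
theorem honestDensity_highFreq {Y₂ : ℝ} (hY : 1 ≤ Y₂) {y : ℝ} (hy : Y₂ < |y|) :
    Real.log (Y₂ / 2) - 2 / Y₂ ^ 2 - π / (2 * Y₂) - Real.log π + 1 - d.decayConst / (1 / 4 + Y₂ ^ 2) - M ≤
      honestDensity d N' Z y := by
  unfold honestDensity
  -- digamma
  set w : ℂ := 1 / 4 + y / 2 * I with hw
  have hwre : w.re = 1 / 4 := by simp [hw]
  have hwim : w.im = y / 2 := by simp [hw]
  have hy0 : 0 < |y| := lt_of_le_of_lt (by linarith) hy
  have hψ := Literature.Analysis.SpecialFunctions.Complex.log_norm_sub_le_re_digamma (w := w)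
    (by rw [hwre]; norm_num) (by rw [hwim]; exact div_ne_zero (abs_pos.1 hy0) two_ne_zero)
  have hnorm : |y| / 2 ≤ ‖w‖ := by
    have := Complex.abs_im_le_norm w
    rw [hwim, abs_div, abs_two] at this
    exact this
  have hnorm0 : 0 < ‖w‖ := lt_of_lt_of_le (by positivity) hnorm
  have hlog : Real.log (Y₂ / 2) ≤ Real.log ‖w‖ :=
    Real.log_le_log (by positivity) ((div_le_div_of_nonneg_right hy.le (by norm_num)).trans hnorm)
  have hr1 : 1 / (2 * ‖w‖ ^ 2) ≤ 2 / Y₂ ^ 2 := by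
    rw [div_le_div_iff₀ (by positivity) (by positivity)]
    have : Y₂ / 2 ≤ ‖w‖ := (div_le_div_of_nonneg_right hy.le (by norm_num)).trans hnorm
    have h2 : (Y₂ / 2) ^ 2 ≤ ‖w‖ ^ 2 := pow_le_pow_left₀ (by positivity) this 2
    nlinarith
  have hr2 : π / (4 * |w.im|) ≤ π / (2 * Y₂) := by
    rw [hwim, abs_div, abs_two]
    refine div_le_div_of_nonneg_left Real.pi_pos.le (by positivity) ?_
    linarith
  have hre : reDigammaQuarter y = (Complex.digamma w).re := rfl
  -- Ê and comb
  have hE : |cosTransform d.kernelE y| ≤ d.decayConst / (1 / 4 + Y₂ ^ 2) := by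
    refine (PWKernel.abs_cosTransform_kernelE_le hdL0 hdh y).trans ?_
    have hC : 0 ≤ d.decayConst := by
      have := (abs_nonneg _).trans (PWKernel.abs_cosTransform_kernelE_le hdL0 hdh 0)
      have hq : (0 : ℝ) < 1 / 4 + 0 ^ 2 := by norm_num
      exact (div_nonneg_iff.1 this).elim (fun h => h.1) fun h => absurd h.2 (not_le.2 hq)
    refine div_le_div_of_nonneg_left hC (by positivity) ?_
    have : Y₂ ^ 2 ≤ y ^ 2 := by
      rw [← sq_abs y]; exact pow_le_pow_left₀ (by linarith) hy.le 2
    linarith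
  have h4 := hcomb y
  have := neg_abs_le (cosTransform d.kernelE y)
  rw [hre]
  linarith

end Bounds

end Summit.RiemannHypothesis.RiemannHypothesis.Theorems.SignCone

end
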